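import Summits.QuantumFields.GaugeBoot.SUNWeakCouplingDeficitRate
import Summits.QuantumFields.GaugeBoot.EquipartitionBoundLimit
import HarnessLib

/-!
# Gauge-boot: THE `SU(N)` PLAQUETTE DEFICIT IS `Θ(1/β_std)` — the two-sided window on every torus and at every
# infinite-volume limit point (supplement 21, part 3h; WHAT REMAINS (xciii))

HONEST FRAMING (cell `pub-gaugeboot`, page 1 of every file): certified bounds on lattice
expectations at STATED coupling, gauge group, dimension and torus size; NOT a mass gap, NOT a
continuum limit, NOT a string tension, NOT large `N`; NOT Yang–Mills-summit-bearing (barriers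
`FixedCouplingUltralocality`, `PerturbativeInvisibility`).  Analytic weak-coupling windows; far wider than the
certificates at the table couplings; they certify no number.

## Content

The equipartition bound (supplement 18, `EquipartitionBound(Limit)`: `1 − u ≥ (N²−1)/(4(D−1)β_std + N²−1)`, all
`L ≥ 2`, all `β_std ≥ 0`) and the free-energy sandwich (part 3f, `SUNRateSharp`: `1 − u ≤ C_N/β_std + C'_N log β/(Lβ_std)`,
all `L`, `β_std ≥ 2N`) in one statement:

* ★★★ `DeficitTheta.plaquetteWindow_theta` — for `N ≥ 2`, `D ≥ 2`, `L₀ ≥ 2`, `β_std ≥ 2N`, the shape-(A) window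
  `PlaquetteWindow N D L₀ β_std (1 − (2/β_std)(16 + (2/D)|a_N + k log 2| + (2/(D−1))|b_N| + (2k/((D−1)L₀)) log(β_std/N)))
  (1 − (N²−1)/(4(D−1)β_std + N²−1))`;
* ★★★ `DeficitTheta.deficit_mem_Icc_of_mem_limitPoints` — at every infinite-volume limit point `μ` of the `SU(N)` torus
  states at `β_std ≥ 2N` and every plaquette of `ℤ^D`:
  **`(N²−1)/(4(D−1)β_std + N²−1) ≤ 1 − ∫(1/N)Re tr U_P dμ ≤ (2/β_std)(16 + (2/D)|a_N + k log 2| + (2/(D−1))|b_N|)`** —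
  both ends of order `1/β_std`: the deficit is `Θ(1/β_std)`, `k = (N²−1)/2`, `a_N`, `b_N` of part 3f.

[folklore] (the two halves are the lane's supplements 18 and 21.)
-/

noncomputable section

open MeasureTheory Filter Topology
open Literature.MathematicalPhysics.QuantumFieldTheory
open Literature.MathematicalPhysics.QuantumLattice (LGConfig plaquetteObs infiniteVolumeLimitPoints)

namespace Summit.QuantumFields.GaugeBoot

namespace DeficitTheta

/-- ★★★ **The `Θ(1/β)` shape-(A) window**: for `N ≥ 2`, `D ≥ 2`, `L₀ ≥ 2`, `β_std ≥ 2N` and every even `L ≥ L₀`,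
`1 − C_N/β_std − (2k/((D−1)L₀)) log(β_std/N)·(2/β_std) ≤ plaquetteExpectation N D L β_std ≤ 1 − (N²−1)/(4(D−1)β_std + N²−1)`. [folklore] -/
theorem plaquetteWindow_theta {N D L₀ : ℕ} (hN : 2 ≤ N) (hD : 2 ≤ D) (hL₀ : 2 ≤ L₀) {β : ℝ} (hβ : 2 * (N : ℝ) ≤ β) :
    PlaquetteWindow N D L₀ β
      (1 - 2 / β * (16 + 2 / D * |SUNRateSharp.aSU N + SUNRateSharp.kSU N * Real.log 2| +
        2 / ((D : ℝ) - 1) * |SUNRateSharp.bSU N| + 2 * SUNRateSharp.kSU N / (((D : ℝ) - 1) * L₀) * Real.log (β / N)))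
      (1 - ((N : ℝ) ^ 2 - 1) / (4 * ((D : ℝ) - 1) * β + ((N : ℝ) ^ 2 - 1))) := by
  intro L _ _ hL
  have hNpos : (0 : ℝ) < N := by exact_mod_cast (show 0 < N by omega)
  have hβ0 : 0 ≤ β := by linarith
  refine ⟨?_, Equipartition.plaquetteExpectation_le_one_sub hN (hL₀.trans hL) hD hβ0⟩
  have h := SUNRateSharp.one_sub_plaquetteExpectation_le (N := N) (D := D) (L := L) hN hD hβ
  -- the finite-size term decreases in `L`
  have hD1 : (0 : ℝ) < (D : ℝ) - 1 := by
    have : (2 : ℝ) ≤ D := by exact_mod_cast hD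
    linarith
  have hlog : 0 ≤ Real.log (β / N) := Real.log_nonneg (by rw [le_div_iff₀ hNpos]; linarith)
  have hk : 0 ≤ SUNRateSharp.kSU N := (SUNRateSharp.kSU_pos hN).le
  have hL₀pos : (0 : ℝ) < L₀ := by exact_mod_cast (show 0 < L₀ by omega)
  have hLL : (L₀ : ℝ) ≤ L := by exact_mod_cast hL
  have hmono : 2 * SUNRateSharp.kSU N / (((D : ℝ) - 1) * L) * Real.log (β / N) ≤
      2 * SUNRateSharp.kSU N / (((D : ℝ) - 1) * L₀) * Real.log (β / N) := by
    refine mul_le_mul_of_nonneg_right ?_ hlog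
    refine div_le_div_of_nonneg_left (by positivity) (by positivity) ?_
    exact mul_le_mul_of_nonneg_left hLL hD1.le
  have hβpos : 0 < β := by linarith
  have h2β : 0 ≤ 2 / β := by positivity
  nlinarith [mul_le_mul_of_nonneg_left hmono h2β]

/-- ★★★ **The deficit is `Θ(1/β_std)` at every infinite-volume limit point**: for `N ≥ 2`, `D ≥ 2`, `β_std ≥ 2N`,
every `μ ∈ infiniteVolumeLimitPoints (suRep N) (β_std/N)` and every plaquette `(x; i ≠ j)` of `ℤ^D`:
`(N²−1)/(4(D−1)β_std + N²−1) ≤ 1 − ∫(1/N)Re tr U_P dμ ≤ (2/β_std)(16 + (2/D)|a_N + k log 2| + (2/(D−1))|b_N|)`. [folklore] -/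
theorem deficit_mem_Icc_of_mem_limitPoints {N D : ℕ} (hN : 2 ≤ N) (hD : 2 ≤ D) {β : ℝ} (hβ : 2 * (N : ℝ) ≤ β)
    {μ : Measure (LGConfig D (SU N))} (hμ : μ ∈ infiniteVolumeLimitPoints (d := D) (suRep N) (β / N))
    (x : Literature.Probability.LatticeModels.Site D) {i j : Fin D} (hij : i ≠ j) :
    1 - ∫ U, (N : ℝ)⁻¹ * plaquetteObs (suRep N) x i j U ∂μ ∈
      Set.Icc (((N : ℝ) ^ 2 - 1) / (4 * ((D : ℝ) - 1) * β + ((N : ℝ) ^ 2 - 1)))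
        (2 / β * (16 + 2 / D * |SUNRateSharp.aSU N + SUNRateSharp.kSU N * Real.log 2| +
          2 / ((D : ℝ) - 1) * |SUNRateSharp.bSU N|)) := by
  have hβ0 : 0 ≤ β := by have : (0 : ℝ) ≤ N := Nat.cast_nonneg N; linarith
  refine ⟨?_, SUNRateSharp.one_sub_integral_plaquette_le_of_mem_limitPoints hN hD hβ hμ x hij⟩
  have h := Equipartition.integral_plaquette_le_of_mem_limitPoints hN hD hβ0 hμ x hij
  linarith

end DeficitTheta

end Summit.QuantumFields.GaugeBoot

end
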